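import Literature.RingTheory.SimpleModule.InvolutionWedderburnBlocks
import Mathlib.LinearAlgebra.Lagrange
import Mathlib.LinearAlgebra.Eigenspace.Basic
import HarnessLib

/-!
# Adjoint-closed matrix units for a semisimple algebra of operators whose centre carries an involution of
# the second kind (Milne 1999, §2, «Simple abelian variety of type IV»: `Ē = M_d × M_d`, `(α, β)† = (βᵗʳ, αᵗʳ)`)

Layer `Literature/RingTheory/SimpleModule`, namespace `Literature.RingTheory.SimpleModule`; pure algebra
(Mathlib + the sibling `InvolutionWedderburnBlocks.lean`), THEOREMS ONLY (no definition, no named fact, no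
`sorry`; D-0026, net debt 0).  Lane `lit-hodgefound` (Track 2 foundations library), prover seat p21,
generation 25, row g25-#1; consumer: the type-4 row of Moonen–Zarhin's Criterion (2) on Weil classes
(`Literature/AlgebraicGeometry/HodgeTheory`, the seat's `CentralTorus.…_of_matrixUnits_…` mechanism, which
takes exactly the matrix units produced here).

## Source, verbatim

J. S. Milne, *Lefschetz classes on abelian varieties*, Duke Math. J. **96** (1999) 639–675 (held text
`paper:doi-10-1215-s0012-7094-99-09620-5`), §2:
* p. 646 (PDF p. 8, L1–L3): «Type IV: `E` is a division algebra with centre a CM-field `K`. […] There exists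
  an isomorphism `E ⊗_ℚ ℝ → M_d(ℂ) × ⋯ × M_d(ℂ)` carrying a Rosati involution into
  `(…, (a_ij), …) ↦ (…, (ā_ji), …)`.»
* p. 651 (PDF p. 13, L1–L50), «Simple abelian variety of type IV»: «`Ē = M_d(k^al) × M_d(k^al)`,
  `(α, β)† = (βᵗʳ, αᵗʳ)`, `K̄ = k^al × k^al` […] Then `†` is an involution on `Ē`, `K̄` is the centre of `Ē`
  […] for each `σ`, there exist compatible isomorphisms `E_σ → Ē`, `(V_σ, φ_σ) → (V̄, φ̄)`, the first of which
  carries the Rosati involution on `E_σ` into the involution `†` on `Ē`».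
* p. 647 (PDF p. 9), Prop. 2.1 and its proof: «any monic irreducible factor of `P_{A,α}(X)` in `ℚ[X]` shares
  a root with `P_{L/ℚ,α}(X)`, and therefore equals it. It follows that […] each `m_i = m`» (uniformity of
  the multiplicities along the places of the centre).

B. J. J. Moonen, Yu. G. Zarhin, *Weil classes on abelian varieties*, J. reine angew. Math. **496** (1998)
(held `paper:arxiv-alg-geom_9612017`), §1 (chunk p0002 L104–L127): «`Δ ⊗ ℂ = ∏_{τ ∈ Σ_{E₀}} Δ_ℂ^{(τ)}`»,
Table 2 (type 4: `M_{dm}(ℂ) × M_{dm}(ℂ)` with the involution exchanging the factors), Lemma (1) «The center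
of `G_div(X)` is the group `U_{K_B}` […] For `X` of type 4 with either `d ≥ 2` or `m ≥ 2` this is a connected
torus».

## What is formalised (any algebraically closed field `K`)

Milne's normal form says: in `Ē = M_d × M_d` with `(α, β)† = (βᵗʳ, αᵗʳ)` the elements
`U_{ab} = (E_{ab}, E_{ab})` are MATRIX UNITS with `U_{ab}† = U_{ba}`, commuting with the centre `K̄`, and
`Ē = K̄⟨U_{ab}⟩`.  We prove the existence of such units INTRINSICALLY, for a semisimple algebra of operators
whose centre is «a CM field with `†` of the second kind», in the vocabulary of `InvolutionWedderburnBlocks`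
(`adj`, `blockIdem`, `bar`, `unit`):

**`exists_matrixUnits_adj_eq_of_center_le_adjoin`.**  `V` a finite-dimensional `K`-space (`K` algebraically
closed) with a non-degenerate alternating form `B`; `E ⊆ End_K V` a semisimple subalgebra stable under the
`B`-adjoint `X ↦ X†`; `T ∈ E` commuting with `E`, killed by the nodal polynomial `∏_{σ ∈ s} (X − σ)` of a
finite set `s ⊂ K` (diagonalisable, spectrum in `s`); the CENTRE of `E` lies in `K[T]`; `ker(T − σ) ∩
ker(T† − σ) = 0` for every `σ` («`T† = T̄ ≠ T` on every eigenspace»: no real place); and `E` has a `K`-basis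
`(Tⁱ b_k)_{i < #s, k < r}` («`E` is free of rank `r` over its centre `K[T] ≅ K^s`»).  THEN there are `d` with
`d² = r` and `U_{ab} ∈ E` (`a, b ∈ Fin d`) with `U_{ab} U_{ce} = δ_{bc} U_{ae}`, `Σ_a U_{aa} = 1`,
`U_{ab}† = U_{ba}`, `U_{ab} T = T U_{ab}`, and `E ≤ K⟨T, U_{ab}⟩`.

Proof (§1–§4): (§1) the Wedderburn block idempotents `1_i` of `E` are central, hence in `K[T]`, hence each
is one of the spectral projectors `P_σ = ℓ_σ(T)` of `T` (`exists_blockIdem_eq_aeval_basis`) — blocks ↔ places;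
(§2) every block has `d_i² = r`: the `d_i²` Wedderburn units of block `i` are linearly independent inside
`E P_σ ⊆ Σ_k K · b_k P_σ` (dimension `≤ r`), while `Σ_i d_i² = dim E = r · #s` and `i ↦ σ(i)` is injective
(`sq_blockSize_eq_of_basis`); (§3) `(1_i)† = 1_{bar i}` with `bar i ≠ i`, because `P_σ† = P_σ` would put
`range P_σ ≠ 0` inside `ker(T − σ) ∩ ker(T† − σ)` (`bar_ne_self_of_eigenspace_inf_eq_bot`); (§4) take the
half-system `H = {i | i < bar i}` of blocks, the Wedderburn units `e^i_{ab}` on `i ∈ H` and their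
adjoint-transposes `(e^i_{ba})†` on `bar i` (the reflection behind `BlockSys.transpose` of the sibling file),
and sum: `U_{ab} = Σ_{i ∈ H} (e^i_{ab} + (e^i_{ba})†)`.

Honest scope: positivity of the involution plays no role (as in Milne's §2 over `k^al`); the «CM» input is
only the eigenvalue condition `ker(T − σ) ∩ ker(T† − σ) = 0`; the freeness of `E` over its centre is an
INPUT here (in the application it comes from `End⁰(X)` being a vector space over its centre `E = ℚ(ψ)` and
the faithfulness of `ℂ ⊗ End⁰(X) → End_ℂ H¹`), and `d` is an OUTPUT (`d² = r`).

## References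

* [Milne1999LefschetzClasses] J. S. Milne, Lefschetz classes on abelian varieties, Duke Math. J. 96 (1999)
  639–675, §2 pp. 645–651 (type IV: p. 646 and p. 651; Prop. 2.1 p. 647).
* [MoonenZarhin1998WeilClasses] B. J. J. Moonen, Yu. G. Zarhin, Weil classes on abelian varieties, J. reine
  angew. Math. 496 (1998) 83–92 = arXiv:alg-geom/9612017, §1 Lemma (1)–(2), Tables 1–2.
* [GoodmanWallachGTM255] R. Goodman, N. Wallach, Symmetry, Representations, and Invariants, GTM 255, §4.1
  (Wedderburn blocks, matrix units).
* [HornJohnson2013] R. A. Horn, C. R. Johnson, Matrix Analysis, 2nd ed. (2013), §1.1, Thm. 1.3.7 ff.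
  (Lagrange interpolation / spectral projectors of a diagonalisable operator).
-/

namespace Literature.RingTheory.SimpleModule

open Polynomial Module Matrix
open scoped BigOperators

variable {K : Type*} [Field K] {V : Type*} [AddCommGroup V] [Module K V]

/-! ### §0 (private) polynomial calculus: Lagrange's spectral projectors -/

section Spectral

/-- `T P = z P` gives `q(T) P = q(z) P`. [folklore] -/
private theorem aeval_mul_eq_eval_smul {T P : Module.End K V} {z : K} (hTP : T * P = z • P) (q : K[X]) :
    aeval T q * P = q.eval z • P := by
  induction q using Polynomial.induction_on' with
  | add p q hp hq => rw [map_add, add_mul, hp, hq, eval_add, add_smul]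
  | monomial n c =>
    have hpow : T ^ n * P = z ^ n • P := by
      induction n with
      | zero => rw [pow_zero, one_mul, pow_zero, one_smul]
      | succ n ih => rw [pow_succ, mul_assoc, hTP, mul_smul_comm, ih, smul_smul, ← pow_succ']
    rw [aeval_monomial, eval_monomial, Algebra.algebraMap_eq_smul_one, smul_mul_assoc, one_mul, smul_mul_assoc,
      hpow, smul_smul]

/-- **Lagrange's spectral projectors** for an operator killed by the nodal polynomial of a finite set `s`:
`P_z = ℓ_z(T)` satisfy `Σ_z P_z = 1`, `P_z P_{z'} = 0` (`z ≠ z'`), `P_z² = P_z`, `T P_z = z P_z`.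
[cite: HornJohnson2013, §1.1 and Thm. 1.3.7 ff.] -/
private theorem lagrange_spectral [DecidableEq K] (T : Module.End K V) (s : Finset K) (hs : s.Nonempty)
    (hT : aeval T (Lagrange.nodal s id) = 0) :
    (∑ z ∈ s, aeval T (Lagrange.basis s id z) = 1) ∧
    (∀ z ∈ s, ∀ z' ∈ s, z ≠ z' → aeval T (Lagrange.basis s id z) * aeval T (Lagrange.basis s id z') = 0) ∧
    (∀ z ∈ s, aeval T (Lagrange.basis s id z) * aeval T (Lagrange.basis s id z) = aeval T (Lagrange.basis s id z)) ∧
    (∀ z ∈ s, T * aeval T (Lagrange.basis s id z) = z • aeval T (Lagrange.basis s id z)) := by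
  classical
  have hinj : Set.InjOn (id : K → K) s := Set.injOn_id _
  have hsum : ∑ z ∈ s, aeval T (Lagrange.basis s id z) = 1 := by
    rw [← map_sum, Lagrange.sum_basis hinj hs, map_one]
  have hbasis : ∀ z ∈ s, Lagrange.basis s id z = C (Lagrange.nodalWeight s id z) * Lagrange.nodal (s.erase z) id := by
    intro z hz
    rw [Lagrange.basis_eq_prod_sub_inv_mul_nodal_div hz, Lagrange.nodal_erase_eq_nodal_div hz]
  have horth : ∀ z ∈ s, ∀ z' ∈ s, z ≠ z' →
      aeval T (Lagrange.basis s id z) * aeval T (Lagrange.basis s id z') = 0 := by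
    intro z hz z' hz' hzz'
    have hz'e : z' ∈ s.erase z := Finset.mem_erase.2 ⟨fun e ↦ hzz' e.symm, hz'⟩
    have hdvd : Lagrange.nodal s id ∣ Lagrange.basis s id z * Lagrange.basis s id z' := by
      rw [hbasis z hz, hbasis z' hz', Lagrange.nodal_eq_mul_nodal_erase hz'e,
        Lagrange.nodal_eq_mul_nodal_erase (s := s) hz']
      exact ⟨C (Lagrange.nodalWeight s id z) * Lagrange.nodal ((s.erase z).erase z') id *
        C (Lagrange.nodalWeight s id z'), by ring⟩
    obtain ⟨r, hr⟩ := hdvd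
    rw [← map_mul, hr, map_mul, hT, zero_mul]
  refine ⟨hsum, horth, fun z hz ↦ ?_, fun z hz ↦ ?_⟩
  · have h1 := congrArg (fun F ↦ aeval T (Lagrange.basis s id z) * F) hsum
    simp only [Finset.mul_sum, mul_one] at h1
    rw [Finset.sum_eq_single z (fun z' hz' hne ↦ horth z hz z' hz' (Ne.symm hne)) (fun h ↦ absurd hz h)] at h1
    exact h1
  · have hpoly : (Polynomial.X - C z) * Lagrange.basis s id z =
        C (Lagrange.nodalWeight s id z) * Lagrange.nodal s id := by
      rw [hbasis z hz, Lagrange.nodal_eq_mul_nodal_erase hz, mul_left_comm]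
      rfl
    have h2 := congrArg (aeval T) hpoly
    rw [map_mul, map_mul, hT, mul_zero, map_sub, aeval_X, aeval_C, sub_mul, sub_eq_zero,
      Module.algebraMap_end_eq_smul_id, smul_mul_assoc] at h2
    rw [h2]
    rfl

/-- Elements of `K[T]` commute with whatever commutes with `T`. [folklore] -/
private theorem mul_comm_of_mem_adjoin_singleton {T X Y : Module.End K V} (hXT : X * T = T * X)
    (hY : Y ∈ Algebra.adjoin K ({T} : Set (Module.End K V))) : X * Y = Y * X := by
  have hle : Algebra.adjoin K ({T} : Set (Module.End K V)) ≤ Subalgebra.centralizer K {X} :=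
    Algebra.adjoin_le (Set.singleton_subset_iff.2 (by
      rw [SetLike.mem_coe, Subalgebra.mem_centralizer_iff]
      rintro _ rfl
      exact hXT))
  have h := hle hY
  rw [Subalgebra.mem_centralizer_iff] at h
  exact (h X rfl)

end Spectral

/-! ### §1 The block idempotents of `E` are spectral projectors of the central element `T` -/

section Blocks

variable [DecidableEq K] (E : Subalgebra K (Module.End K V)) {t : ℕ} {dd : Fin t → ℕ} (hd : ∀ i, NeZero (dd i))
  (ψ : E ≃ₐ[K] Π i, Matrix (Fin (dd i)) (Fin (dd i)) K)
  {T : Module.End K V} (hT : T ∈ E) (hTc : ∀ X ∈ E, X * T = T * X)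
  (s : Finset K) (hTs : aeval T (Lagrange.nodal s id) = 0)
  (hZ : ∀ z ∈ E, (∀ X ∈ E, X * z = z * X) → z ∈ Algebra.adjoin K ({T} : Set (Module.End K V)))

omit [DecidableEq K] in
include hT in
/-- `K[T] ⊆ E`. [folklore] -/
private theorem adjoin_le : Algebra.adjoin K ({T} : Set (Module.End K V)) ≤ E :=
  Algebra.adjoin_le (Set.singleton_subset_iff.2 hT)

include hd hT hTc hTs hZ in
/-- **Blocks are places.**  Every Wedderburn block idempotent `1_i` of `E` is a spectral projector
`P_z = ℓ_z(T)` of the central element `T`, for some `z ∈ s` with `P_z ≠ 0`: `1_i` is central, so lies in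
`K[T]` (the hypothesis on the centre), so `1_i = q(T) = Σ_z q(z) P_z` with `q(z) ∈ {0, 1}` wherever
`P_z ≠ 0`; a `P_z` below `1_i` is a non-zero central idempotent of `E` concentrated in block `i`, hence equal
to `1_i`. [cite: Milne1999LefschetzClasses, §2 p. 646 («F ⊗ k = F_1 × ⋯ × F_t … 1 = e_1 + ⋯ + e_t») and p. 651 («K̄ is the centre of Ē»)] -/
theorem exists_blockIdem_eq_aeval_basis (hs : s.Nonempty) (i : Fin t) :
    ∃ z ∈ s, aeval T (Lagrange.basis s id z) ≠ 0 ∧ blockIdem E ψ i = aeval T (Lagrange.basis s id z) := by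
  classical
  haveI := hd
  obtain ⟨hPsum, hPorth, hPidem, hTP⟩ := lagrange_spectral T s hs hTs
  set P : K → Module.End K V := fun z ↦ aeval T (Lagrange.basis s id z) with hPdef
  have hPE : ∀ z, P z ∈ E := fun z ↦ adjoin_le E hT (by
    rw [Algebra.adjoin_singleton_eq_range_aeval]; exact ⟨_, rfl⟩)
  -- `1_i ∈ K[T]`, `1_i = q(T)`
  have h1c : ∀ X ∈ E, X * blockIdem E ψ i = blockIdem E ψ i * X := fun X hX ↦ blockIdem_comm E ψ hX i
  have h1T : blockIdem E ψ i ∈ Algebra.adjoin K ({T} : Set (Module.End K V)) :=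
    hZ _ (blockIdem_mem E ψ i) h1c
  rw [Algebra.adjoin_singleton_eq_range_aeval] at h1T
  obtain ⟨q, hq⟩ := h1T
  replace hq : aeval T q = blockIdem E ψ i := hq
  have h1P : ∀ z ∈ s, blockIdem E ψ i * P z = q.eval z • P z := fun z hz ↦ by
    rw [← hq]; exact aeval_mul_eq_eval_smul (hTP z hz) q
  -- some `P z₀` below `1_i` is non-zero, with `q(z₀) = 1`
  have hne : blockIdem E ψ i ≠ 0 := blockIdem_ne_zero E ψ hd i
  have hexp : blockIdem E ψ i = ∑ z ∈ s, q.eval z • P z := by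
    conv_lhs => rw [← mul_one (blockIdem E ψ i), ← hPsum, Finset.mul_sum]
    exact Finset.sum_congr rfl fun z hz ↦ h1P z hz
  obtain ⟨z₀, hz₀, hqz₀⟩ : ∃ z₀ ∈ s, q.eval z₀ • P z₀ ≠ 0 :=
    Finset.exists_ne_zero_of_sum_ne_zero (hexp ▸ hne)
  have hPz₀ : P z₀ ≠ 0 := fun h ↦ hqz₀ (by rw [h, smul_zero])
  have hq1 : q.eval z₀ = 1 := by
    have hsq : blockIdem E ψ i * blockIdem E ψ i = blockIdem E ψ i := by
      rw [blockIdem_mul_blockIdem, if_pos rfl]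
    have h2 : (q.eval z₀ * q.eval z₀) • P z₀ = q.eval z₀ • P z₀ := by
      have h2' : blockIdem E ψ i * blockIdem E ψ i * P z₀ = blockIdem E ψ i * P z₀ := by rw [hsq]
      rwa [mul_assoc, h1P z₀ hz₀, mul_smul_comm, h1P z₀ hz₀, smul_smul] at h2'
    have h3 : (q.eval z₀ * q.eval z₀ - q.eval z₀) • P z₀ = 0 := by rw [sub_smul, h2, sub_self]
    rw [smul_eq_zero] at h3
    rcases h3 with h3 | h3
    · have hq0 : q.eval z₀ ≠ 0 := fun h ↦ hqz₀ (by rw [h, zero_smul])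
      have : q.eval z₀ * (q.eval z₀ - 1) = 0 := by rw [mul_sub, mul_one, h3]
      rcases mul_eq_zero.1 this with h4 | h4
      · exact absurd h4 hq0
      · exact sub_eq_zero.1 h4
    · exact absurd h3 hPz₀
  have hbelow : blockIdem E ψ i * P z₀ = P z₀ := by rw [h1P z₀ hz₀, hq1, one_smul]
  -- `P z₀` is a central idempotent of `E` concentrated in block `i`, hence `= 1_i`
  refine ⟨z₀, hz₀, hPz₀, ?_⟩
  let p : E := ⟨P z₀, hPE z₀⟩
  have hp2 : p * p = p := Subtype.ext (hPidem z₀ hz₀)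
  have hpc : ∀ x : E, x * p = p * x := fun x ↦ Subtype.ext
    (mul_comm_of_mem_adjoin_singleton (hTc x x.2) (by
      rw [Algebra.adjoin_singleton_eq_range_aeval]; exact ⟨_, rfl⟩))
  have h01 : ∀ j, ψ p j = 0 ∨ ψ p j = 1 := fun j ↦ apply_eq_zero_or_one_of_central_idempotent E ψ hp2 hpc j
  have hψ1 : ψ (⟨blockIdem E ψ i, blockIdem_mem E ψ i⟩ : E) = Pi.single i 1 := by
    have h1 : (⟨blockIdem E ψ i, blockIdem_mem E ψ i⟩ : E) = ψ.symm (Pi.single i 1) := Subtype.ext rfl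
    rw [h1, AlgEquiv.apply_symm_apply]
  have hprod : ψ p = Pi.single i (1 : Matrix (Fin (dd i)) (Fin (dd i)) K) * ψ p := by
    have h2 : (⟨blockIdem E ψ i, blockIdem_mem E ψ i⟩ : E) * p = p := Subtype.ext hbelow
    rw [← hψ1, ← map_mul, h2]
  have hpj : ∀ j, j ≠ i → ψ p j = 0 := fun j hj ↦ by
    have h := congrFun hprod j
    rw [Pi.mul_apply, Pi.single_eq_of_ne hj, zero_mul] at h
    exact h
  have hpi : ψ p i = 1 := by
    rcases h01 i with h | h
    · exfalso
      apply hPz₀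
      have hψp : ψ p = 0 := by
        funext j
        by_cases hj : j = i
        · rw [hj, Pi.zero_apply]; exact h
        · rw [Pi.zero_apply]; exact hpj j hj
      have hp0 : p = 0 := by simpa using congrArg ψ.symm hψp
      exact congrArg Subtype.val hp0
    · exact h
  have hψp : ψ p = Pi.single i 1 := by
    funext j
    by_cases hj : j = i
    · rw [hj, Pi.single_eq_same]; exact hpi
    · rw [Pi.single_eq_of_ne hj]; exact hpj j hj
  have hp : p = ψ.symm (Pi.single i 1) := by rw [← hψp, AlgEquiv.symm_apply_apply]
  calc blockIdem E ψ i = ((ψ.symm (Pi.single i 1) : E) : Module.End K V) := rfl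
    _ = (p : Module.End K V) := by rw [hp]
    _ = P z₀ := rfl

/-! ### §2 All blocks have the same size -/

omit [DecidableEq K] in
/-- The Wedderburn units `e^i_{ab}` of one block are linearly independent (they are the pull-backs of the
elementary matrices). [cite: GoodmanWallachGTM255, §4.1] -/
theorem linearIndependent_unit (i : Fin t) :
    LinearIndependent K (fun ac : Fin (dd i) × Fin (dd i) ↦ unit E ψ i ac.1 ac.2) := by
  classical
  -- the elementary matrices are linearly independent
  have hstd : LinearIndependent K (fun ac : Fin (dd i) × Fin (dd i) ↦ Matrix.single ac.1 ac.2 (1 : K)) := by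
    rw [Fintype.linearIndependent_iff]
    intro g hg ac
    have h := congrFun (congrFun hg ac.1) ac.2
    rw [Matrix.sum_apply, Matrix.zero_apply] at h
    simp only [Matrix.smul_apply, Matrix.single_apply, smul_eq_mul, mul_ite, mul_one, mul_zero] at h
    rw [Finset.sum_eq_single ac] at h
    · simpa using h
    · rintro ac' - hne
      rw [if_neg]
      rintro ⟨h1, h2⟩
      exact hne (Prod.ext h1 h2)
    · intro h'; exact absurd (Finset.mem_univ _) h'
  -- transported along the injective linear map `M ↦ ψ⁻¹ (single i M)`
  let L : Matrix (Fin (dd i)) (Fin (dd i)) K →ₗ[K] Module.End K V :=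
    E.val.toLinearMap ∘ₗ (ψ.symm.toLinearEquiv.toLinearMap ∘ₗ
      LinearMap.single K (fun j ↦ Matrix (Fin (dd j)) (Fin (dd j)) K) i)
  have hL : ∀ M, L M = ((ψ.symm (Pi.single i M) : E) : Module.End K V) := fun M ↦ rfl
  have hLinj : Function.Injective L := by
    intro M M' h
    rw [hL, hL] at h
    exact Pi.single_injective i (ψ.symm.injective (Subtype.ext h))
  have hcomp : (fun ac : Fin (dd i) × Fin (dd i) ↦ unit E ψ i ac.1 ac.2) =
      L ∘ fun ac : Fin (dd i) × Fin (dd i) ↦ Matrix.single ac.1 ac.2 (1 : K) := by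
    funext ac; rfl
  rw [hcomp]
  exact hstd.map' L (LinearMap.ker_eq_bot.2 hLinj)

include ψ hd hT hTc hTs hZ in
/-- **All blocks have the same size `d`, `d² = r`** («each `m_i = m`»): if `E` has a `K`-basis
`(Tʲ b_k)_{j < #s, k < r}`, then for every Wedderburn block `i`, `d_i² = r`.  Indeed `1_i = P_σ` for a place
`σ = σ(i) ∈ s` (injectively in `i`), the `d_i²` units of block `i` are linearly independent elements of
`E P_σ ⊆ Σ_k K · b_k P_σ` (so `d_i² ≤ r`), and `Σ_i d_i² = dim E = #s · r ≥ t · r`.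
[cite: Milne1999LefschetzClasses, §2 Prop. 2.1 (p. 647) and its proof] -/
theorem sq_blockSize_eq_of_basis (hs : s.Nonempty) {r : ℕ} {b : Fin r → Module.End K V}
    (hb : LinearIndependent K (fun jk : Fin s.card × Fin r ↦ T ^ (jk.1 : ℕ) * b jk.2))
    (hspan : Subalgebra.toSubmodule E =
      Submodule.span K (Set.range fun jk : Fin s.card × Fin r ↦ T ^ (jk.1 : ℕ) * b jk.2))
    (i : Fin t) : dd i * dd i = r := by
  classical
  haveI := hd
  obtain ⟨hPsum, hPorth, hPidem, hTP⟩ := lagrange_spectral T s hs hTs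
  choose z hz hPz h1 using fun j ↦ exists_blockIdem_eq_aeval_basis E hd ψ hT hTc s hTs hZ hs j
  have hzinj : Function.Injective z := fun j j' hjj' ↦
    blockIdem_injective E ψ hd (by rw [h1 j, h1 j', hjj'])
  -- the `b_k` lie in `E`
  have hscard : 0 < s.card := Finset.card_pos.2 hs
  have hbE : ∀ k, b k ∈ E := fun k ↦ by
    have h : T ^ (((⟨0, hscard⟩ : Fin s.card), k).1 : ℕ) * b ((⟨0, hscard⟩ : Fin s.card), k).2 ∈
        Subalgebra.toSubmodule E := by
      rw [hspan]; exact Submodule.subset_span ⟨(⟨0, hscard⟩, k), rfl⟩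
    rw [Subalgebra.mem_toSubmodule, pow_zero, one_mul] at h
    exact h
  -- every block: `d_j² ≤ r`
  have hle : ∀ j, dd j * dd j ≤ r := by
    intro j
    set Pz : Module.End K V := aeval T (Lagrange.basis s id (z j)) with hPzdef
    -- `E P_σ ⊆ Σ_k K · b_k P_σ`
    let W : Submodule K (Module.End K V) := LinearMap.range (Fintype.linearCombination K fun k ↦ b k * Pz)
    have hWspan : W = Submodule.span K (Set.range fun k ↦ b k * Pz) := Fintype.range_linearCombination K _
    have hEW : ∀ Y₀ ∈ E, Y₀ * Pz ∈ W := by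
      intro Y₀ hY₀
      rw [hWspan]
      have hY₀' : Y₀ ∈ Subalgebra.toSubmodule E := hY₀
      rw [hspan] at hY₀'
      clear hY₀
      induction hY₀' using Submodule.span_induction with
      | mem Y hY =>
        obtain ⟨jk, rfl⟩ := hY
        have hcomm : Commute (b jk.2) T := hTc _ (hbE jk.2)
        have hc : b jk.2 * T ^ (jk.1 : ℕ) = T ^ (jk.1 : ℕ) * b jk.2 := hcomm.pow_right _
        have hTPz : T ^ (jk.1 : ℕ) * Pz = z j ^ (jk.1 : ℕ) • Pz := by
          have h := aeval_mul_eq_eval_smul (hTP (z j) (hz j)) (Polynomial.X ^ (jk.1 : ℕ) : K[X])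
          rwa [aeval_X_pow, eval_pow, eval_X] at h
        show T ^ (jk.1 : ℕ) * b jk.2 * Pz ∈ _
        rw [← hc, mul_assoc, hTPz, mul_smul_comm]
        exact Submodule.smul_mem _ _ (Submodule.subset_span ⟨jk.2, rfl⟩)
      | zero => rw [zero_mul]; exact Submodule.zero_mem _
      | add Y Y' _ _ hY hY' => rw [add_mul]; exact Submodule.add_mem _ hY hY'
      | smul c Y _ hY => rw [smul_mul_assoc]; exact Submodule.smul_mem _ _ hY
    -- the units of block `j` lie in `W`
    have hunitW : ∀ ac : Fin (dd j) × Fin (dd j), unit E ψ j ac.1 ac.2 ∈ W := fun ac ↦ by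
      have h := hEW _ (unit_mem E ψ j ac.1 ac.2)
      rwa [hPzdef, ← h1 j, unit_mul_blockIdem] at h
    -- and are linearly independent there
    have hli : LinearIndependent K (fun ac : Fin (dd j) × Fin (dd j) ↦ (⟨unit E ψ j ac.1 ac.2, hunitW ac⟩ : W)) := by
      apply LinearIndependent.of_comp W.subtype
      exact linearIndependent_unit E ψ j
    have hcard := hli.fintype_card_le_finrank
    rw [Fintype.card_prod, Fintype.card_fin] at hcard
    have hWr : Module.finrank K W ≤ r := by
      refine (LinearMap.finrank_range_le _).trans ?_
      rw [Module.finrank_fintype_fun_eq_card, Fintype.card_fin]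
    exact hcard.trans hWr
  -- total dimension
  have hdimE : Module.finrank K E = s.card * r := by
    rw [← Subalgebra.finrank_toSubmodule, hspan, finrank_span_eq_card hb, Fintype.card_prod, Fintype.card_fin,
      Fintype.card_fin]
  have hdimE' : Module.finrank K E = ∑ j, dd j * dd j := by
    rw [LinearEquiv.finrank_eq ψ.toLinearEquiv, Module.finrank_pi_fintype]
    exact Finset.sum_congr rfl fun j _ ↦ by simp [Module.finrank_matrix]
  have ht : t ≤ s.card := by
    have h := Finset.card_le_card_of_injOn (s := Finset.univ) z (fun j _ ↦ hz j) (hzinj.injOn)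
    rwa [Finset.card_univ, Fintype.card_fin] at h
  -- conclude
  by_contra hne
  have hlt : dd i * dd i < r := lt_of_le_of_ne (hle i) hne
  have hsum : ∑ j, dd j * dd j < ∑ _j : Fin t, r :=
    Finset.sum_lt_sum (fun j _ ↦ hle j) ⟨i, Finset.mem_univ _, hlt⟩
  rw [Finset.sum_const, Finset.card_univ, Fintype.card_fin, smul_eq_mul, ← hdimE', hdimE] at hsum
  exact absurd (Nat.mul_le_mul_right r ht) (not_le.2 hsum)

/-! ### §3 The adjoint exchanges the blocks in pairs -/

include hT hTc hTs hZ in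
/-- **The adjoint involution moves every block: `bar i ≠ i`** («`†` is of the second kind on the centre»).
If `(1_i)† = 1_i` with `1_i = P_σ`, then `P_σ T† = (T P_σ)† = σ P_σ`, so the non-zero space `P_σ V` lies in
`ker(T − σ) ∩ ker(T† − σ) = 0`. [cite: Milne1999LefschetzClasses, §2 p. 651 («(α, β)† = (βᵗʳ, αᵗʳ)»: † exchanges the two factors)] -/
theorem bar_ne_self_of_eigenspace_inf_eq_bot [FiniteDimensional K V] (B : LinearMap.BilinForm K V)
    (hB : B.Nondegenerate) (hBa : B.IsAlt) (hE : ∀ X ∈ E, adj B hB X ∈ E)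
    (hCM : ∀ σ : K, T.eigenspace σ ⊓ (adj B hB T).eigenspace σ = ⊥) (hs : s.Nonempty) (i : Fin t) :
    bar B hB hBa E hE hd ψ i ≠ i := by
  classical
  haveI := hd
  intro hbi
  obtain ⟨z, hz, hPz, h1⟩ := exists_blockIdem_eq_aeval_basis E hd ψ hT hTc s hTs hZ hs i
  obtain ⟨-, -, -, hTP⟩ := lagrange_spectral T s hs hTs
  set Pz : Module.End K V := aeval T (Lagrange.basis s id z) with hPzdef
  have hadjP : adj B hB Pz = Pz := by rw [← h1, adj_blockIdem B hB hBa E hE hd ψ i, hbi]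
  have hTPz : T * Pz = z • Pz := hTP z hz
  have h2 : Pz * adj B hB T = z • Pz := by
    have h := congrArg (adj B hB) hTPz
    rwa [adj_mul, adj_smul, hadjP] at h
  have hcomm : adj B hB T * Pz = Pz * adj B hB T :=
    mul_comm_of_mem_adjoin_singleton (hTc _ (hE T hT)) (by
      rw [Algebra.adjoin_singleton_eq_range_aeval]; exact ⟨_, rfl⟩)
  obtain ⟨w, hw⟩ := DFunLike.ne_iff.1 hPz
  rw [LinearMap.zero_apply] at hw
  have hv1 : Pz w ∈ T.eigenspace z := by
    rw [Module.End.mem_eigenspace_iff, ← Module.End.mul_apply, hTPz, LinearMap.smul_apply]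
  have hv2 : Pz w ∈ (adj B hB T).eigenspace z := by
    rw [Module.End.mem_eigenspace_iff, ← Module.End.mul_apply, hcomm, h2, LinearMap.smul_apply]
  have hv : Pz w ∈ T.eigenspace z ⊓ (adj B hB T).eigenspace z := ⟨hv1, hv2⟩
  rw [hCM z, Submodule.mem_bot] at hv
  exact hw hv

end Blocks

/-! ### §4 The adjoint-closed matrix units -/

section Main

variable [DecidableEq K] [FiniteDimensional K V]

/-- **Milne 1999, §2, type IV: adjoint-closed matrix units** (`Ē = M_d × M_d`, `(α, β)† = (βᵗʳ, αᵗʳ)`, on a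
module).  Let `K` be algebraically closed, `V ≠ 0` finite-dimensional with a non-degenerate alternating form
`B`, `E ⊆ End_K V` a semisimple subalgebra stable under the `B`-adjoint `†`, `T ∈ E` central in `E` with
`∏_{σ ∈ s} (T − σ) = 0`, such that the centre of `E` lies in `K[T]`, `ker(T − σ) ∩ ker(T† − σ) = 0` for all
`σ`, and `E` has a `K`-basis `(Tʲ b_k)_{j < #s, k < r}`.  Then there are `d ≥ 1` with `d² = r` and
`U_{ab} ∈ E` (`a, b < d`) with `U_{ab} U_{ce} = δ_{bc} U_{ae}`, `Σ_a U_{aa} = 1`, `U_{ab}† = U_{ba}`,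
`U_{ab} T = T U_{ab}`, and `E ⊆ K⟨T, U_{ab}⟩`.  Construction: `U_{ab} = Σ_{i ∈ H} (e^i_{ab} + (e^i_{ba})†)`
over the half-system `H = {i | i < bar i}` of Wedderburn blocks.
[cite: Milne1999LefschetzClasses, §2 p. 646 («E ⊗ ℝ → M_d(ℂ) × ⋯ × M_d(ℂ) carrying a Rosati involution into (a_ij) ↦ (ā_ji)») and p. 651 («Ē = M_d(k^al) × M_d(k^al), (α, β)† = (βᵗʳ, αᵗʳ) … compatible isomorphisms E_σ → Ē»)]
[cite: MoonenZarhin1998WeilClasses, §1 Lemma (1)–(2) and Table 2 (type 4)] [cite: GoodmanWallachGTM255, §4.1] -/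
theorem exists_matrixUnits_adj_eq_of_center_le_adjoin [IsAlgClosed K] [Nontrivial V]
    (B : LinearMap.BilinForm K V) (hB : B.Nondegenerate) (hBa : B.IsAlt)
    (E : Subalgebra K (Module.End K V)) [IsSemisimpleRing E] (hE : ∀ X ∈ E, adj B hB X ∈ E)
    {T : Module.End K V} (hT : T ∈ E) (hTc : ∀ X ∈ E, X * T = T * X)
    (s : Finset K) (hTs : aeval T (Lagrange.nodal s id) = 0)
    (hZ : ∀ z ∈ E, (∀ X ∈ E, X * z = z * X) → z ∈ Algebra.adjoin K ({T} : Set (Module.End K V)))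
    (hCM : ∀ σ : K, T.eigenspace σ ⊓ (adj B hB T).eigenspace σ = ⊥)
    {r : ℕ} {b : Fin r → Module.End K V}
    (hb : LinearIndependent K (fun jk : Fin s.card × Fin r ↦ T ^ (jk.1 : ℕ) * b jk.2))
    (hspan : Subalgebra.toSubmodule E =
      Submodule.span K (Set.range fun jk : Fin s.card × Fin r ↦ T ^ (jk.1 : ℕ) * b jk.2)) :
    ∃ (d : ℕ) (U : Fin d → Fin d → Module.End K V), 0 < d ∧ d * d = r ∧ (∀ a c, U a c ∈ E) ∧
      (∀ a c c' e, U a c * U c' e = if c = c' then U a e else 0) ∧ (∑ a, U a a = 1) ∧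
      (∀ a c, adj B hB (U a c) = U c a) ∧ (∀ a c, U a c * T = T * U a c) ∧
      E ≤ Algebra.adjoin K (insert T (Set.range fun ac : Fin d × Fin d ↦ U ac.1 ac.2)) := by
  classical
  -- `s ≠ ∅` (as `V ≠ 0`)
  have hs : s.Nonempty := by
    rw [Finset.nonempty_iff_ne_empty]
    rintro rfl
    rw [Lagrange.nodal_empty, map_one] at hTs
    exact one_ne_zero hTs
  -- Wedderburn
  haveI : FiniteDimensional K E := FiniteDimensional.of_injective E.val.toLinearMap Subtype.val_injective
  obtain ⟨t, dd, hd, ⟨ψ⟩⟩ := IsSemisimpleRing.exists_algEquiv_pi_matrix_of_isAlgClosed K E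
  haveI := hd
  set br : Fin t → Fin t := bar B hB hBa E hE hd ψ with hbr
  have hbrbr : ∀ i, br (br i) = i := bar_bar B hB hBa E hE hd ψ
  have hbrne : ∀ i, br i ≠ i := bar_ne_self_of_eigenspace_inf_eq_bot E hd ψ hT hTc s hTs hZ B hB hBa hE hCM hs
  have hsq : ∀ i, dd i * dd i = r := sq_blockSize_eq_of_basis E hd ψ hT hTc s hTs hZ hs hb hspan
  choose z hz hPz h1 using fun j ↦ exists_blockIdem_eq_aeval_basis E hd ψ hT hTc s hTs hZ hs j
  -- there is a block (`E ∋ 1 ≠ 0`)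
  have ht : 0 < t := by
    rcases Nat.eq_zero_or_pos t with ht0 | ht0
    · exfalso
      subst ht0
      have h : (1 : E) = 0 := ψ.injective (Subsingleton.elim _ _)
      exact one_ne_zero (congrArg Subtype.val h)
    · exact ht0
  set i₀ : Fin t := ⟨0, ht⟩
  set d : ℕ := dd i₀ with hddef
  have hdi : ∀ i, dd i = d := fun i ↦ Nat.mul_self_inj.1 (by rw [hsq i, hsq i₀])
  -- reindexed Wedderburn units `u i a c = e^i_{ac}` and their adjoint-transposes `f i a c = (e^i_{ca})†`
  let κ : ∀ i, Fin d → Fin (dd i) := fun i a ↦ Fin.cast (hdi i).symm a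
  have hκinj : ∀ i, Function.Injective (κ i) := fun i ↦ Fin.cast_injective _
  let u : Fin t → Fin d → Fin d → Module.End K V := fun i a c ↦ unit E ψ i (κ i a) (κ i c)
  let f : Fin t → Fin d → Fin d → Module.End K V := fun i a c ↦ adj B hB (u i c a)
  have hu_mem : ∀ i a c, u i a c ∈ E := fun i a c ↦ unit_mem E ψ i _ _
  have hf_mem : ∀ i a c, f i a c ∈ E := fun i a c ↦ hE _ (hu_mem i c a)
  have hu_mul : ∀ i a c c' e, u i a c * u i c' e = if c = c' then u i a e else 0 := by
    intro i a c c' e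
    show unit E ψ i (κ i a) (κ i c) * unit E ψ i (κ i c') (κ i e) = _
    rw [unit_mul_unit]
    by_cases hc : c = c'
    · rw [if_pos hc, if_pos (congrArg (κ i) hc)]
    · rw [if_neg hc, if_neg fun h ↦ hc (hκinj i h)]
  have hu_mul_ne : ∀ {i j}, i ≠ j → ∀ a c c' e, u i a c * u j c' e = 0 := fun hij a c c' e ↦
    unit_mul_unit_of_ne E ψ hij _ _ _ _
  have hu_one : ∀ i a c, u i a c * blockIdem E ψ i = u i a c := fun i a c ↦ unit_mul_blockIdem E ψ i _ _
  have hone_u : ∀ i a c, blockIdem E ψ i * u i a c = u i a c := fun i a c ↦ blockIdem_mul_unit E ψ i _ _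
  have hf_one : ∀ i a c, f i a c * blockIdem E ψ (br i) = f i a c := fun i a c ↦ by
    show adj B hB (u i c a) * blockIdem E ψ (br i) = adj B hB (u i c a)
    rw [hbr, ← adj_blockIdem B hB hBa E hE hd ψ i, ← adj_mul, hone_u]
  have hone_f : ∀ i a c, blockIdem E ψ (br i) * f i a c = f i a c := fun i a c ↦ by
    show blockIdem E ψ (br i) * adj B hB (u i c a) = adj B hB (u i c a)
    rw [hbr, ← adj_blockIdem B hB hBa E hE hd ψ i, ← adj_mul, hu_one]
  have hf_mul : ∀ i a c c' e, f i a c * f i c' e = if c = c' then f i a e else 0 := by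
    intro i a c c' e
    show adj B hB (u i c a) * adj B hB (u i e c') = _
    rw [← adj_mul, hu_mul]
    by_cases hc : c = c'
    · rw [if_pos hc.symm, if_pos hc]
    · rw [if_neg (Ne.symm hc), if_neg hc, adj_zero]
  have hf_mul_ne : ∀ {i j}, i ≠ j → ∀ a c c' e, f i a c * f j c' e = 0 := fun {i j} hij a c c' e ↦ by
    show adj B hB (u i c a) * adj B hB (u j e c') = 0
    rw [← adj_mul, hu_mul_ne (Ne.symm hij), adj_zero]
  have hone_one : ∀ {i j}, i ≠ j → blockIdem E ψ i * blockIdem E ψ j = 0 := fun hij ↦ by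
    rw [blockIdem_mul_blockIdem, if_neg hij]
  have huf : ∀ {i j}, i ≠ br j → ∀ a c c' e, u i a c * f j c' e = 0 := fun {i j} hij a c c' e ↦ by
    rw [← hu_one i, ← hone_f j, mul_assoc, ← mul_assoc (blockIdem E ψ i), hone_one hij, zero_mul, mul_zero]
  have hfu : ∀ {i j}, br i ≠ j → ∀ a c c' e, f i a c * u j c' e = 0 := fun {i j} hij a c c' e ↦ by
    rw [← hf_one i, ← hone_u j, mul_assoc, ← mul_assoc (blockIdem E ψ (br i)), hone_one hij, zero_mul, mul_zero]
  -- the half-system of blocks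
  let H : Finset (Fin t) := Finset.univ.filter fun i ↦ i < br i
  have hH : ∀ {i}, i ∈ H ↔ i < br i := by simp [H]
  have hH1 : ∀ {i}, i ∈ H → br i ∉ H := fun {i} hi h ↦ by
    rw [hH] at hi h; rw [hbrbr] at h; exact lt_asymm hi h
  have hH2 : ∀ {i}, i ∉ H → br i ∈ H := fun {i} hi ↦ by
    rw [hH] at hi ⊢; rw [hbrbr]
    exact lt_of_le_of_ne (not_lt.1 hi) (hbrne i)
  have hHne : ∀ {i j}, i ∈ H → j ∈ H → i ≠ br j := fun hi hj h ↦ hH1 hj (h ▸ hi)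
  -- the units
  let U : Fin d → Fin d → Module.End K V := fun a c ↦ ∑ i ∈ H, (u i a c + f i a c)
  have hU : ∀ a c, U a c = ∑ i ∈ H, (u i a c + f i a c) := fun a c ↦ rfl
  have hUmem : ∀ a c, U a c ∈ E := fun a c ↦
    Subalgebra.sum_mem _ fun i _ ↦ E.add_mem (hu_mem i a c) (hf_mem i a c)
  -- block components of `U`
  have hU_one : ∀ {j}, j ∈ H → ∀ a c, U a c * blockIdem E ψ j = u j a c := fun {j} hj a c ↦ by
    rw [hU, Finset.sum_mul]
    have hterm : ∀ i ∈ H, (u i a c + f i a c) * blockIdem E ψ j = if i = j then u j a c else 0 := by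
      intro i hi
      rw [add_mul]
      have hf0 : f i a c * blockIdem E ψ j = 0 := by
        rw [← hf_one, mul_assoc, hone_one (fun h ↦ hH1 hi (by rw [h]; exact hj)), mul_zero]
      rw [hf0, add_zero]
      by_cases hij : i = j
      · subst hij; rw [if_pos rfl, hu_one]
      · rw [if_neg hij]; exact unit_mul_blockIdem_of_ne E ψ hij _ _
    rw [Finset.sum_congr rfl hterm, Finset.sum_ite_eq' H j, if_pos hj]
  have hone_U : ∀ {j}, j ∈ H → ∀ a c, blockIdem E ψ (br j) * U a c = f j a c := fun {j} hj a c ↦ by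
    rw [hU, Finset.mul_sum]
    have hterm : ∀ i ∈ H, blockIdem E ψ (br j) * (u i a c + f i a c) = if i = j then f j a c else 0 := by
      intro i hi
      rw [mul_add]
      have hu0 : blockIdem E ψ (br j) * u i a c = 0 := by
        rw [← hone_u, ← mul_assoc, hone_one (fun h ↦ hH1 hj (by rw [h]; exact hi)), zero_mul]
      rw [hu0, zero_add]
      by_cases hij : i = j
      · subst hij; rw [if_pos rfl, hone_f]
      · rw [if_neg hij, ← hone_f, ← mul_assoc,
          hone_one (fun h ↦ hij (bar_injective B hB hBa E hE hd ψ h).symm), zero_mul]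
    rw [Finset.sum_congr rfl hterm, Finset.sum_ite_eq' H j, if_pos hj]
  refine ⟨d, U, Nat.pos_of_ne_zero (NeZero.ne _), hsq i₀, hUmem, ?_, ?_, ?_, fun a c ↦ hTc _ (hUmem a c), ?_⟩
  · -- multiplication table
    intro a c c' e
    rw [hU a c, hU c' e, Finset.sum_mul_sum]
    have hterm : ∀ i ∈ H, ∀ j ∈ H, (u i a c + f i a c) * (u j c' e + f j c' e) =
        if i = j then (if c = c' then u i a e + f i a e else 0) else 0 := by
      intro i hi j hj
      rw [add_mul, mul_add, mul_add, huf (hHne hi hj), hfu (Ne.symm (hHne hj hi))]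
      by_cases hij : i = j
      · subst hij
        rw [if_pos rfl, hu_mul, hf_mul, add_zero, zero_add]
        split_ifs <;> simp
      · rw [if_neg hij, hu_mul_ne hij, hf_mul_ne hij]; simp
    rw [Finset.sum_congr rfl fun i hi ↦ Finset.sum_congr rfl fun j hj ↦ hterm i hi j hj]
    simp_rw [Finset.sum_ite_eq]
    rw [Finset.sum_congr rfl fun i hi ↦ if_pos hi]
    split_ifs with hc
    · rfl
    · exact Finset.sum_const_zero
  · -- `Σ_a U_{aa} = 1`
    rw [Finset.sum_comm]
    have hdiag : ∀ i, ∑ a, u i a a = blockIdem E ψ i := by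
      intro i
      rw [← sum_unit_diag E ψ i]
      exact Fintype.sum_equiv (finCongr (hdi i).symm) _ _ fun a ↦ rfl
    have hdiag' : ∀ i, ∑ a, f i a a = blockIdem E ψ (br i) := by
      intro i
      show ∑ a, adj B hB (u i a a) = _
      rw [← adj_sum, hdiag, hbr, adj_blockIdem B hB hBa E hE hd ψ]
    have hsum : ∀ i ∈ H, ∑ a, (u i a a + f i a a) = blockIdem E ψ i + blockIdem E ψ (br i) := fun i _ ↦ by
      rw [Finset.sum_add_distrib, hdiag, hdiag']
    rw [Finset.sum_congr rfl hsum, Finset.sum_add_distrib]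
    have hreindex : ∑ i ∈ H, blockIdem E ψ (br i) = ∑ i ∈ Finset.univ.filter (fun i ↦ ¬ i < br i), blockIdem E ψ i := by
      refine Finset.sum_nbij' br br (fun i hi ↦ ?_) (fun i hi ↦ ?_) (fun i _ ↦ hbrbr i) (fun i _ ↦ hbrbr i)
        (fun i _ ↦ rfl)
      · have h := hH1 hi
        simpa [H] using h
      · have hi' : i ∉ H := by simpa [H] using hi
        exact hH2 hi'
    rw [hreindex]
    show ∑ i ∈ Finset.univ.filter (fun i ↦ i < br i), blockIdem E ψ i +
      ∑ i ∈ Finset.univ.filter (fun i ↦ ¬ i < br i), blockIdem E ψ i = 1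
    rw [Finset.sum_filter_add_sum_filter_not, sum_blockIdem]
  · -- `U_{ac}† = U_{ca}`
    intro a c
    rw [hU, hU, adj_sum]
    refine Finset.sum_congr rfl fun i _ ↦ ?_
    show adj B hB (u i a c + adj B hB (u i c a)) = u i c a + adj B hB (u i a c)
    rw [adj_add, adj_adj_of_isAlt B hB hBa, add_comm]
  · -- `E ≤ K⟨T, U⟩`
    intro X hX
    set A := Algebra.adjoin K (insert T (Set.range fun ac : Fin d × Fin d ↦ U ac.1 ac.2)) with hAdef
    have hTA : Algebra.adjoin K ({T} : Set (Module.End K V)) ≤ A :=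
      Algebra.adjoin_mono (Set.singleton_subset_iff.2 (Set.mem_insert _ _))
    have honeA : ∀ j, blockIdem E ψ j ∈ A := fun j ↦ hTA (by
      rw [h1 j, Algebra.adjoin_singleton_eq_range_aeval]; exact ⟨_, rfl⟩)
    have hUA : ∀ a c, U a c ∈ A := fun a c ↦ Algebra.subset_adjoin (Set.mem_insert_of_mem _ ⟨(a, c), rfl⟩)
    have huA : ∀ {j}, j ∈ H → ∀ a c, u j a c ∈ A := fun hj a c ↦ by
      rw [← hU_one hj]; exact A.mul_mem (hUA a c) (honeA _)
    have hfA : ∀ {j}, j ∈ H → ∀ a c, f j a c ∈ A := fun hj a c ↦ by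
      rw [← hone_U hj]; exact A.mul_mem (honeA _) (hUA a c)
    -- reindexing the Wedderburn units of a block through `κ`
    have hunit_eq : ∀ j (a' c' : Fin (dd j)), unit E ψ j a' c' = u j (Fin.cast (hdi j) a') (Fin.cast (hdi j) c') := by
      intro j a' c'
      rfl
    rw [eq_sum_blockIdem_mul_mul_blockIdem E ψ hX]
    refine Subalgebra.sum_mem _ fun j _ ↦ ?_
    by_cases hj : j ∈ H
    · -- a block of the half-system: its Wedderburn units are `U_{ac} 1_j`
      have hmem := blockIdem_mul_mem_mul_blockIdem E ψ hX j
      refine (Submodule.span_le.2 ?_ : _ ≤ Subalgebra.toSubmodule A) hmem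
      rintro _ ⟨ac, rfl⟩
      rw [SetLike.mem_coe, Subalgebra.mem_toSubmodule]
      show unit E ψ j ac.1 ac.2 ∈ A
      rw [hunit_eq]
      exact huA hj _ _
    · -- a conjugate block `j = bar i`: `1_j X 1_j = (1_i X† 1_i)†` and the `(e^i_{ca})† = 1_j U_{ac}` span it
      have hi : br j ∈ H := hH2 hj
      have hflip : blockIdem E ψ j * X * blockIdem E ψ j =
          adj B hB (blockIdem E ψ (br j) * adj B hB X * blockIdem E ψ (br j)) := by
        rw [adj_mul, adj_mul, adj_adj_of_isAlt B hB hBa, hbr, adj_blockIdem B hB hBa E hE hd ψ, ← hbr, hbrbr,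
          mul_assoc]
      have hmem := blockIdem_mul_mem_mul_blockIdem E ψ (hE X hX) (br j)
      have hmem' : adjLinear B hB (blockIdem E ψ (br j) * adj B hB X * blockIdem E ψ (br j)) ∈
          Submodule.map (adjLinear B hB)
            (Submodule.span K (Set.range fun ac : Fin (dd (br j)) × Fin (dd (br j)) ↦ unit E ψ (br j) ac.1 ac.2)) :=
        Submodule.mem_map_of_mem hmem
      rw [Submodule.map_span, adjLinear_apply, ← hflip] at hmem'
      refine (Submodule.span_le.2 ?_ : _ ≤ Subalgebra.toSubmodule A) hmem'
      rintro _ ⟨_, ⟨ac, rfl⟩, rfl⟩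
      rw [SetLike.mem_coe, Subalgebra.mem_toSubmodule, adjLinear_apply]
      show adj B hB (unit E ψ (br j) ac.1 ac.2) ∈ A
      rw [hunit_eq]
      exact hfA hi _ _

end Main

end Literature.RingTheory.SimpleModule
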